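/-
Copyright (c) 2026 the pub-hodgecm-mathlib formalisation cell (harness21).  Prover seat hodgecm-mathlib-K2E5-p16 (g6), Track B «K2-LIT»,
#184♮ = hLiu418 = `stmt-HodgeConjecture-24832`; organ S2-J, (J2⊗-arch) FILE 2a `K2LiuArchTensorFrameChase` (LEAD F0P6-plan (g14) BATCH #20 (1);
K2Liu-p05 (g5) 13:14:07Z target): the INDEX CHASE identifying the sign-frame matrix of `(h ⊗ 1)_σ` with Konno–Konno's `toBig (h_σ, 1)` relabelled —
`reindex (signSplit z)² (scaleConj D (reindex e² (K ⊗ₖ 1))) = reindex E² (reindex dpEquiv² ((reindex (signSplit x)² (scaleConj D₁ K)) ⊗ₖ 1))` for any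
frame identification `E` compatible with the two sign splittings.  THEOREMS ONLY (no `def`, no `instance`, no notation, no `sorry`).
-/
import Summits.HodgeConjecture.HodgeConjecture.Theorems.K2LiuArchTensorPlaceSecMatrix    -- ★ FILE 1 (this seat)
import Literature.RepresentationTheory.KonnoKonno2007.RealUnitaryDualPair              -- ★ `dpEquiv`, `DPIdx`, `toBig`, `coe_toBig`
import HarnessLib

/-!
# Crux `HLiu418`, organ S2-J, (J2⊗-arch) FILE 2a: the frame chase `toUForm_𝕎((h ⊗ 1)_σ) = relabel (toBig (toUForm_𝔻 h_σ, 1))` at the matrix level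

Cell `hodgecm-mathlib`, crux item hLiu418 = `stmt-HodgeConjecture-24832` (helper lane `--supports`, count-neutral).

Matrix currencies: ★ `coe_toUForm` (`toUForm ε D … k = reindex ε ε (scaleConj D k)`), ★ `coe_toBig` (`toBig (g_V, g_W) = reindex dpEquiv dpEquiv (g_V ⊗ₖ g_W)`),
★ `K2Lit.DoubledTensorEmbedding.coe_tensorEmb` (`tensorEmb h = reindex epsD epsD (h ⊗ₖ 1)`), ★ FILE 1 `scaleConj_reindex_kronecker_one`.
* `frameCompatible` (hypothesis shape, no def): an identification `E : DPIdx (PosIdx x) (NegIdx x) (PosIdx y) (NegIdx y) ≃ PosIdx z ⊕ NegIdx z` is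
  COMPATIBLE when `dpEquiv⁻¹ (E⁻¹ i) = (signSplit x a, signSplit y b)` with `(a, b) = e⁻¹ ((signSplit z)⁻¹ i)`;
* `sumCongr_tensorEquiv_compatible`: ★ J0's `posIdxTensorEquiv ⊕ negIdxTensorEquiv` (adapter-keyed on `z`) IS compatible;
* **`reindex_signSplit_scaleConj_tensor`**: for compatible `E`, block-diagonal `K` is not even needed —
  `reindex (signSplit z) (signSplit z) (scaleConj D (reindex e e (K ⊗ₖ 1))) = reindex E E (reindex dpEquiv dpEquiv ((reindex (signSplit x) (signSplit x) (scaleConj D₁ K)) ⊗ₖ 1))`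
  (`D_{e(a,b)} = D₁_a · D₂_b`, `D₂ ≠ 0`) — i.e. `toUForm_𝕎 ((h ⊗ 1)_σ) = relabel E (toBig (toUForm_𝔻 h_σ, 1))` entry by entry.
FILE 2b wraps this with ★ `placeSec_apply` ∕ ★ `toUForm_toUFormEquiv_symm` ∕ the arch component of ★ `tensorEmb` into
`tensorEmb (placeSec_𝔻 σ h) = placeSec_𝕎 σ (relabel E (toBig (h, 1)))`.
References: [KonnoKonno2007, §3.1 (3.1)]; [Kudla1994, §2]; [MoeglinVignerasWaldspurger1987, Ch. 1 I.17].
HONEST LABEL: HC_CM is proved only modulo the 7 printed citations (2 remaining named inputs: hLiu418 = stmt-HodgeConjecture-24832,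
h413 = stmt-HodgeConjecture-24833) until rung 0 closes; count-neutral helper, closes no socket.
-/

set_option autoImplicit false
set_option linter.dupNamespace false

noncomputable section

open Matrix
open scoped Kronecker

namespace Summit.HodgeConjecture.HodgeConjecture.Cruxes.HLiu418.K2LiuArchTensorFrameChase

open Literature.NumberTheory.Weil1964 (PosIdx NegIdx signSplit scaleConj scaleConj_apply)
open Literature.RepresentationTheory.HeisenbergGroup Literature.Analysis.SegalBargmann
open Literature.RepresentationTheory.KonnoKonno2007 Literature.RepresentationTheory.KonnoKonno2007.RealDualPair
open K2LiuArchTensorSignFrames (posIdxTensorEquiv negIdxTensorEquiv)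

variable {N M n : ℕ}

/-- `signSplit` sends a positive index to the left summand. [folklore] -/
theorem signSplit_apply_of_pos (x : Fin N → ℝ) (a : Fin N) (h : 0 < x a) : signSplit x a = Sum.inl ⟨a, h⟩ :=
  Equiv.sumCompl_symm_apply_of_pos (p := fun j => 0 < x j) (a := a) h

/-- `signSplit` sends a non-positive index to the right summand. [folklore] -/
theorem signSplit_apply_of_not_pos (x : Fin N → ℝ) (a : Fin N) (h : ¬0 < x a) : signSplit x a = Sum.inr ⟨a, h⟩ :=
  Equiv.sumCompl_symm_apply_of_neg (p := fun j => 0 < x j) (a := a) h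

/-- `(signSplit z)⁻¹ (inl k) = k` and `(signSplit z)⁻¹ (inr k) = k` on underlying indices. [folklore] -/
theorem signSplit_symm_apply (z : Fin n → ℝ) :
    (∀ k : PosIdx z, (signSplit z).symm (Sum.inl k) = k.1) ∧ ∀ k : NegIdx z, (signSplit z).symm (Sum.inr k) = k.1 :=
  ⟨fun _ => rfl, fun _ => rfl⟩

/-- **★ J0's tensor sign equivalences are COMPATIBLE with the two sign splittings through `dpEquiv`**:
`dpEquiv⁻¹ ((eP ⊕ eQ)⁻¹ i) = (signSplit x a, signSplit y b)`, `(a,b) = e⁻¹((signSplit z)⁻¹ i)`, for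
`eP = (posIdxTensorEquiv ∘ adapter)⁻¹`, `eQ = (negIdxTensorEquiv ∘ adapter)⁻¹`. [cite: KonnoKonno2007, §3.1 (3.1)] -/
theorem sumCongr_tensorEquiv_compatible (x : Fin N → ℝ) (y : Fin M → ℝ) (e : Fin N × Fin M ≃ Fin n) (hx : ∀ i, x i ≠ 0)
    (hy : ∀ j, y j ≠ 0) (z : Fin n → ℝ) (hz : ∀ k, z k = x (e.symm k).1 * y (e.symm k).2) (i : PosIdx z ⊕ NegIdx z) :
    (dpEquiv (PosIdx x) (NegIdx x) (PosIdx y) (NegIdx y)).symm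
        ((Equiv.sumCongr
            ((Equiv.subtypeEquivRight (fun k => by rw [hz k]) : PosIdx z ≃ PosIdx (fun k => x (e.symm k).1 * y (e.symm k).2)).trans
              (posIdxTensorEquiv x y e hx hy)).symm
            ((Equiv.subtypeEquivRight (fun k => by rw [hz k]) : NegIdx z ≃ NegIdx (fun k => x (e.symm k).1 * y (e.symm k).2)).trans
              (negIdxTensorEquiv x y e hx hy)).symm).symm i) =
      (signSplit x (e.symm ((signSplit z).symm i)).1, signSplit y (e.symm ((signSplit z).symm i)).2) := by
  rcases i with k | k
  · -- positive index of `z`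
    rw [Equiv.sumCongr_symm, Equiv.sumCongr_apply, Sum.map_inl, Equiv.symm_symm, Equiv.trans_apply]
    have hk : 0 < x (e.symm k.1).1 * y (e.symm k.1).2 := by rw [← hz]; exact k.2
    by_cases ha : 0 < x (e.symm k.1).1
    · rw [K2LiuArchTensorSignFrames.posIdxTensorEquiv_apply_of_pos x y e hx hy _ ha]
      show ((Sum.inl _ : PosIdx x ⊕ NegIdx x), (Sum.inl _ : PosIdx y ⊕ NegIdx y)) = _
      rw [(signSplit_symm_apply z).1 k, signSplit_apply_of_pos x _ ha,
        signSplit_apply_of_pos y _ (K2LiuArchTensorSignFrames.pos_right_of_mul_pos hk ha)]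
      rfl
    · rw [K2LiuArchTensorSignFrames.posIdxTensorEquiv_apply_of_not_pos x y e hx hy _ ha]
      show ((Sum.inr _ : PosIdx x ⊕ NegIdx x), (Sum.inr _ : PosIdx y ⊕ NegIdx y)) = _
      rw [(signSplit_symm_apply z).1 k, signSplit_apply_of_not_pos x _ ha,
        signSplit_apply_of_not_pos y _ (K2LiuArchTensorSignFrames.not_pos_right_of_mul_pos hk ha)]
      rfl
  · -- non-positive index of `z`
    rw [Equiv.sumCongr_symm, Equiv.sumCongr_apply, Sum.map_inr, Equiv.symm_symm, Equiv.trans_apply]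
    have hk : ¬0 < x (e.symm k.1).1 * y (e.symm k.1).2 := by rw [← hz]; exact k.2
    by_cases ha : 0 < x (e.symm k.1).1
    · rw [K2LiuArchTensorSignFrames.negIdxTensorEquiv_apply_of_pos x y e hx hy _ ha]
      show ((Sum.inl _ : PosIdx x ⊕ NegIdx x), (Sum.inr _ : PosIdx y ⊕ NegIdx y)) = _
      rw [(signSplit_symm_apply z).2 k, signSplit_apply_of_pos x _ ha,
        signSplit_apply_of_not_pos y _ (K2LiuArchTensorSignFrames.not_pos_right_of_not_mul_pos hk ha)]
      rfl
    · rw [K2LiuArchTensorSignFrames.negIdxTensorEquiv_apply_of_not_pos x y e hx hy _ ha]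
      show ((Sum.inr _ : PosIdx x ⊕ NegIdx x), (Sum.inl _ : PosIdx y ⊕ NegIdx y)) = _
      rw [(signSplit_symm_apply z).2 k, signSplit_apply_of_not_pos x _ ha,
        signSplit_apply_of_pos y _ (K2LiuArchTensorSignFrames.pos_right_of_not_mul_pos hk ha (hx _) (hy _))]
      rfl

/-- **THE FRAME CHASE** (`toUForm_𝕎 ((h ⊗ 1)_σ) = relabel E (toBig (toUForm_𝔻 h_σ, 1))` entry by entry): for ANY identification `E` compatible
with the sign splittings through `dpEquiv` and scalings `D_{e(a,b)} = D₁_a · D₂_b` (`D₂ ≠ 0`),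
`reindex (signSplit z) (signSplit z) (scaleConj D (reindex e e (K ⊗ₖ 1)))
   = reindex E E (reindex dpEquiv dpEquiv ((reindex (signSplit x) (signSplit x) (scaleConj D₁ K)) ⊗ₖ 1))`.
[cite: KonnoKonno2007, §3.1 (3.1); Kudla1994, §2] -/
theorem reindex_signSplit_scaleConj_tensor (x : Fin N → ℝ) (y : Fin M → ℝ) (e : Fin N × Fin M ≃ Fin n) (z : Fin n → ℝ)
    (D₁ : Fin N → ℝ) (D₂ : Fin M → ℝ) (hD₂ : ∀ j, D₂ j ≠ 0) (D : Fin n → ℝ) (hD : ∀ k, D k = D₁ (e.symm k).1 * D₂ (e.symm k).2)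
    (K : Matrix (Fin N) (Fin N) ℂ) (E : DPIdx (PosIdx x) (NegIdx x) (PosIdx y) (NegIdx y) ≃ PosIdx z ⊕ NegIdx z)
    (hE : ∀ i, (dpEquiv (PosIdx x) (NegIdx x) (PosIdx y) (NegIdx y)).symm (E.symm i) =
      (signSplit x (e.symm ((signSplit z).symm i)).1, signSplit y (e.symm ((signSplit z).symm i)).2)) :
    Matrix.reindex (signSplit z) (signSplit z) (scaleConj D (Matrix.reindex e e (K ⊗ₖ (1 : Matrix (Fin M) (Fin M) ℂ)))) =
      Matrix.reindex E E (Matrix.reindex (dpEquiv (PosIdx x) (NegIdx x) (PosIdx y) (NegIdx y)) (dpEquiv (PosIdx x) (NegIdx x) (PosIdx y) (NegIdx y))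
        (Matrix.reindex (signSplit x) (signSplit x) (scaleConj D₁ K) ⊗ₖ (1 : Matrix (PosIdx y ⊕ NegIdx y) (PosIdx y ⊕ NegIdx y) ℂ))) := by
  rw [K2LiuArchTensorPlaceSecMatrix.scaleConj_reindex_kronecker_one D₁ D₂ hD₂ e D hD K]
  ext i j
  rw [Matrix.reindex_apply, Matrix.submatrix_apply, Matrix.reindex_apply, Matrix.submatrix_apply, Matrix.kroneckerMap_apply,
    Matrix.reindex_apply, Matrix.submatrix_apply, Matrix.reindex_apply, Matrix.submatrix_apply, hE i, hE j, Matrix.kroneckerMap_apply,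
    Matrix.reindex_apply, Matrix.submatrix_apply, Equiv.symm_apply_apply, Equiv.symm_apply_apply,
    Matrix.one_apply, Matrix.one_apply]
  by_cases hb : (e.symm ((signSplit z).symm i)).2 = (e.symm ((signSplit z).symm j)).2
  · rw [if_pos hb, if_pos (congrArg (signSplit y) hb)]
  · rw [if_neg hb, if_neg (fun h => hb ((signSplit y).injective h))]

end Summit.HodgeConjecture.HodgeConjecture.Cruxes.HLiu418.K2LiuArchTensorFrameChase

end
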